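import Summits.CriticalPhenomena.PercolationContinuityZ3.Theorems.PercNearOneGluingNoHeavyLowerTailSahiOneStepRayleighMatroid
import Summits.CriticalPhenomena.PercolationContinuityZ3.Theorems.PercNearOneGluingNoHeavyLowerTailSahiOneStepCone
import Summits.CriticalPhenomena.PercolationContinuityZ3.Theorems.PercNearOneGluingNoHeavyLowerTailSahiOneStepDisjointSupport
import Summits.CriticalPhenomena.PercolationContinuityZ3.Theorems.PercNearOneGluingNoHeavyLowerTailSahiOneStepSubblockThresholdFree
import HarnessLib

/-!
# One-step scheme: a first slot satisfying `(2′)` for all dictator pairs at all densities is the complement of a MATROID complex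

Support file (prover prim-ineq-prove-3 gen 34; `--supports stmt-CriticalPhenomena-4575`; memo
`run/shared/lean/prim/prim-ineq-prove-3/FINDING-G33-KERNEL-FORMS.md` §7, Theorem 7.3).  The `(2′)` half of the one-step scheme,
`0 ≤ n(H; 1_A, 1_B)` (`SahiOneStep.osN`; `Cov(A,B) ≥ μ(Hᶜ)·Cov(A,B ∣ Hᶜ)`), is the route's hypothesis for Hamming-threshold first
slots `H = {N_F ≥ t}`.  Gen 33 observed numerically that the first slots for which it can hold against all partner pairs are exactly
the complements of (independence-correlated) matroid complexes; `…SahiOneStepNonMatroidSlot` put the smallest counterexample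
`x_a(x_b ∨ x_c)` in the kernel.  This file proves the NECESSITY HALF in general:
* `osN_dictator_eq` — for dictators `A = {e ∈ ω}`, `B = {f ∈ ω}` (`e ≠ f`):
  `n(H; 1_A, 1_B) = μ(Hᶜ∩[e])·μ(Hᶜ∩[f]) − μ(Hᶜ)·μ(Hᶜ∩[e]∩[f])`, i.e. dictator-`(2′)` is pairwise non-positive correlation under
  `μ(· ∣ Hᶜ)` (Wagner's Rayleigh condition / Semple–Welsh independence correlation for `Hᶜ`);
* `prodBernoulli_real_eq_rmass` — probabilities under `prodBernoulli p` as masses `rmass` of families of finite sets;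
* `isRayleighFamily_slotComplex_of_osN_nonneg`, `dictator_osN_nonneg_iff_isRayleighFamily` — dictator-`(2′)` at all densities ⟺
  `IsRayleighFamily (slotComplex H)`;
* **`exists_matroid_of_dictator_osN_nonneg`** — if `H` is an up-set with `∅ ∉ H` and `0 ≤ n(H; 1_{[e]}, 1_{[f]})` for all `e ≠ f`
  and all `p : ι → [0,1]`, then there is a `Matroid ι` whose independent finite sets are exactly those not in `H`.
* `exists_matroid_of_osN_nonneg_upperSets` — the same with the hypothesis for all pairs of up-sets (the "good slot" property).
* `exists_matroid_of_condNC` — the same stated without `osN`: if `μ(Hᶜ∩[e]∩[f])·μ(Hᶜ) ≤ μ(Hᶜ∩[e])·μ(Hᶜ∩[f])` for every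
  `prodBernoulli p` and all `e ≠ f`, then `Hᶜ` is a matroid complex.
* `isRayleighFamily_slotComplex_threshold` — the Hamming-threshold slots themselves ARE Rayleigh (uniform matroids are
  independence-correlated), via the cell's THEOREM D `osN_disjoint_nonneg` (…SahiOneStepDisjointSupport).
* `exists_matroid_threshold` — non-vacuity: the threshold slots give Mathlib matroids (`M.Indep ↑I ↔ |I ∩ F| < t`).
So every "good first slot" of the `(2′)` inequality is the dependent-set family of a (Rayleigh) matroid; the cell's Hamming
thresholds are the uniform matroids.  (The converse fails for non-Rayleigh matroids, e.g. `S₈`, memo §7.4 — not formalised.)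
No definitions, no named facts, no sorries, no `native_decide`.
-/

noncomputable section

namespace Summit.CriticalPhenomena.PercolationContinuityZ3.Theorems

namespace SahiOneStep

open Finset

variable {ι : Type*} [Fintype ι] [DecidableEq ι]

/-! ## Bridge: product-measure probabilities as masses, and the dictator form of `(2′)` -/

section Bridge

open scoped Classical
open MeasureTheory
open Literature.Probability.Percolation (prodBernoulli_real_eq_sum_weight_ind DeterminedBy determinedBy_iff)
open Literature.Probability.Percolation.BHK2006 (weight)
open Literature.Probability.Percolation.DecisionTree (ind ind_of_mem ind_of_not_mem)
open Literature.Probability.LatticeModels (prodBernoulli prodBernoulli_real_setOf_mem prodBernoulli_real_subset)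

/-- The probability of an event under `prodBernoulli p` is the mass of the family of finite sets it contains. [folklore] -/
theorem prodBernoulli_real_eq_rmass (p : ι → unitInterval) (C : Set (Set ι)) :
    (prodBernoulli p).real C = rmass (fun i => (p i : ℝ)) (Finset.univ.filter fun S : Finset ι => (↑S : Set ι) ∈ C) := by
  classical
  rw [prodBernoulli_real_eq_sum_weight_ind]
  unfold rmass
  rw [Finset.sum_filter]
  rw [← Fintype.sum_equiv Fintype.finsetEquivSet
    (fun S : Finset ι => if (↑S : Set ι) ∈ C then rwt (fun i => (p i : ℝ)) S else 0)
    (fun a : Set ι => weight (fun e => (p e : ℝ)) a * ind C a) ?_]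
  intro S
  rw [Fintype.finsetEquivSet_apply]
  have hw : weight (fun e => (p e : ℝ)) (↑S : Set ι) = rwt (fun i => (p i : ℝ)) S := by
    unfold weight rwt
    refine Finset.prod_congr rfl fun e _ => ?_
    by_cases he : e ∈ S
    · rw [if_pos (Finset.mem_coe.mpr he), if_pos he]
    · rw [if_neg (fun h => he (Finset.mem_coe.mp h)), if_neg he]
  by_cases hC : (↑S : Set ι) ∈ C
  · rw [if_pos hC, hw, ind_of_mem hC, mul_one]
  · rw [if_neg hC, ind_of_not_mem hC, mul_zero]

omit [DecidableEq ι] in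
/-- **Dictator form of the `(2′)` functional.**  For two distinct coordinates `e ≠ f` and any first event `H` with
complement `L = Hᶜ`: `n(H; 1_{[e]}, 1_{[f]}) = μ(L ∩ [e])·μ(L ∩ [f]) − μ(L)·μ(L ∩ [e] ∩ [f])`, i.e. `(2′)` for the
dictator pair is non-positive correlation of `e, f` under `μ( · ∣ Hᶜ)`. [this work] -/
theorem osN_dictator_eq (p : ι → unitInterval) (H : Set (Set ι)) {e f : ι} (hef : e ≠ f) :
    osN p H (ind {ω : Set ι | e ∈ ω}) (ind {ω : Set ι | f ∈ ω}) =
      (prodBernoulli p).real (Hᶜ ∩ {ω | e ∈ ω}) * (prodBernoulli p).real (Hᶜ ∩ {ω | f ∈ ω})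
        - (prodBernoulli p).real Hᶜ * (prodBernoulli p).real (Hᶜ ∩ {ω | e ∈ ω} ∩ {ω | f ∈ ω}) := by
  classical
  rw [osN_ind_ind]
  have hsplit : ∀ X : Set (Set ι), (prodBernoulli p).real (H ∩ X) =
      (prodBernoulli p).real X - (prodBernoulli p).real (Hᶜ ∩ X) := by
    intro X
    have h := measureReal_inter_add_sdiff (μ := prodBernoulli p) (s := X) (t := H) MeasurableSet.of_discrete
    rw [Set.inter_comm X H, Set.sdiff_eq_compl_inter] at h
    linarith
  have hH : (prodBernoulli p).real H = 1 - (prodBernoulli p).real Hᶜ := by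
    have h := measureReal_add_measureReal_compl (μ := prodBernoulli p) (s := H) MeasurableSet.of_discrete
    rw [probReal_univ] at h
    linarith
  -- `μ{e ∈ ω ∧ f ∈ ω} = p_e p_f` (this is `SahiOneStep.real_mem_inter_mem` of …NonMatroidSlot, re-derived locally to keep the import closure small)
  have hpair : (prodBernoulli p).real ({ω : Set ι | e ∈ ω} ∩ {ω | f ∈ ω}) = (p e : ℝ) * p f := by
    have hset : ({ω : Set ι | e ∈ ω} ∩ {ω | f ∈ ω}) = {ω | ((({e, f} : Finset ι)) : Set ι) ⊆ ω} := by
      ext ω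
      simp only [Set.mem_inter_iff, Set.mem_setOf_eq, Finset.coe_insert, Finset.coe_singleton, Set.insert_subset_iff,
        Set.singleton_subset_iff]
    rw [hset, prodBernoulli_real_subset, Finset.prod_pair hef]
  rw [Set.inter_assoc H, hsplit, hsplit, hsplit, hH, hpair, prodBernoulli_real_setOf_mem,
    prodBernoulli_real_setOf_mem, ← Set.inter_assoc]
  ring


omit [DecidableEq ι] in
/-- Membership in the slot complex. [this work] -/
theorem mem_slotComplex {H : Set (Set ι)} {S : Finset ι} : S ∈ slotComplex H ↔ (↑S : Set ι) ∉ H := by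
  simp [slotComplex]

omit [DecidableEq ι] in
/-- The complement of an up-set is a down-closed family. [folklore] -/
theorem isLowerSet_slotComplex {H : Set (Set ι)} (hH : IsUpperSet H) : IsLowerSet (slotComplex H : Set (Finset ι)) := by
  intro S T hTS hS
  rw [Finset.mem_coe, mem_slotComplex] at hS ⊢
  exact fun hT => hS (hH (Finset.coe_subset.mpr hTS) hT)

/-- Probabilities of sub-events of `Hᶜ` cut out by a property of the (finite) configuration are masses of sub-families of the slot
complex. [this work] -/
theorem prodBernoulli_real_eq_rmass_slotComplex (p : ι → unitInterval) (H C : Set (Set ι)) (P : Finset ι → Prop)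
    [DecidablePred P] (hC : ∀ S : Finset ι, (↑S : Set ι) ∈ C ↔ ((↑S : Set ι) ∉ H ∧ P S)) :
    (prodBernoulli p).real C = rmass (fun i => (p i : ℝ)) ((slotComplex H).filter P) := by
  classical
  rw [prodBernoulli_real_eq_rmass]
  unfold rmass
  refine Finset.sum_congr ?_ (fun _ _ => rfl)
  ext S
  simp only [Finset.mem_filter, Finset.mem_univ, true_and, slotComplex, hC S]

/-- The four probabilities entering the dictator form of `(2′)`, as masses of the slot complex and its sections. [this work] -/
theorem prodBernoulli_real_compl_dictators (p : ι → unitInterval) (H : Set (Set ι)) (e f : ι) :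
    (prodBernoulli p).real (Hᶜ ∩ {ω | e ∈ ω}) = rmass (fun i => (p i : ℝ)) ((slotComplex H).filter fun S => e ∈ S) ∧
    (prodBernoulli p).real (Hᶜ ∩ {ω | f ∈ ω}) = rmass (fun i => (p i : ℝ)) ((slotComplex H).filter fun S => f ∈ S) ∧
    (prodBernoulli p).real (Hᶜ ∩ {ω | e ∈ ω} ∩ {ω | f ∈ ω}) =
      rmass (fun i => (p i : ℝ)) ((slotComplex H).filter fun S => e ∈ S ∧ f ∈ S) ∧
    (prodBernoulli p).real Hᶜ = rmass (fun i => (p i : ℝ)) (slotComplex H) := by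
  classical
  refine ⟨prodBernoulli_real_eq_rmass_slotComplex p H _ _ fun S => by simp,
    prodBernoulli_real_eq_rmass_slotComplex p H _ _ fun S => by simp,
    prodBernoulli_real_eq_rmass_slotComplex p H _ _ fun S => by simp [and_assoc], ?_⟩
  have h := prodBernoulli_real_eq_rmass_slotComplex p H Hᶜ (fun _ => True) fun S => by simp
  rw [Finset.filter_true] at h
  exact h

/-- **Dictator `(2′)` at all densities ⟹ the complement of the first slot is a Rayleigh family.** [this work] -/
theorem isRayleighFamily_slotComplex_of_osN_nonneg {H : Set (Set ι)}
    (hpos : ∀ (p : ι → unitInterval) (e f : ι), e ≠ f →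
      0 ≤ osN p H (ind {ω : Set ι | e ∈ ω}) (ind {ω : Set ι | f ∈ ω})) :
    IsRayleighFamily (slotComplex H) := by
  classical
  intro p h0 h1 e f hef
  set p' : ι → unitInterval := fun i => ⟨p i, ⟨h0 i, h1 i⟩⟩ with hp'
  have hpp : (fun i => (p' i : ℝ)) = p := funext fun i => rfl
  obtain ⟨hE, hF, hEF, hL⟩ := prodBernoulli_real_compl_dictators p' H e f
  have H0 := hpos p' e f hef
  rw [osN_dictator_eq p' H hef, hE, hF, hEF, hL, hpp] at H0
  linarith

/-- **Converse bookkeeping: a Rayleigh complement gives dictator-`(2′)` at every density.**  Together with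
`isRayleighFamily_slotComplex_of_osN_nonneg`: dictator-`(2′)` for the first slot `H` at all densities is EQUIVALENT to the
Rayleigh property of `slotComplex H`. [this work] -/
theorem osN_dictator_nonneg_of_isRayleighFamily {H : Set (Set ι)} (hR : IsRayleighFamily (slotComplex H))
    (p : ι → unitInterval) {e f : ι} (hef : e ≠ f) :
    0 ≤ osN p H (ind {ω : Set ι | e ∈ ω}) (ind {ω : Set ι | f ∈ ω}) := by
  classical
  obtain ⟨hE, hF, hEF, hL⟩ := prodBernoulli_real_compl_dictators p H e f
  have H0 := hR (fun i => (p i : ℝ)) (fun i => (p i).2.1) (fun i => (p i).2.2) e f hef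
  rw [osN_dictator_eq p H hef, hE, hF, hEF, hL]
  linarith

/-- **Dictator-`(2′)` at all densities ⟺ the complement of the first slot is a Rayleigh family.** [this work] -/
theorem dictator_osN_nonneg_iff_isRayleighFamily (H : Set (Set ι)) :
    (∀ (p : ι → unitInterval) (e f : ι), e ≠ f → 0 ≤ osN p H (ind {ω : Set ι | e ∈ ω}) (ind {ω : Set ι | f ∈ ω})) ↔
      IsRayleighFamily (slotComplex H) :=
  ⟨isRayleighFamily_slotComplex_of_osN_nonneg, fun hR p _ _ hef => osN_dictator_nonneg_of_isRayleighFamily hR p hef⟩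

/-- **THEOREM (necessity of the matroid structure for the `(2′)` first slot).**  Let `H` be an increasing event on the
finite cube `2^ι` with `∅ ∉ H`.  If the `(2′)` inequality `0 ≤ n(H; 1_A, 1_B)` (`Cov(A,B) ≥ μ(Hᶜ)·Cov(A,B ∣ Hᶜ)`) holds for every
DICTATOR pair `A = {e ∈ ω}`, `B = {f ∈ ω}` (`e ≠ f`) under EVERY product measure `prodBernoulli p`, then the complement of `H`
is the family of independent sets of a matroid on `ι`: there is `M : Matroid ι` with `M.Indep ↑I ↔ ↑I ∉ H` for all finite `I`.
(The dictator case of `(2′)` is Wagner's Rayleigh condition for `Hᶜ`; Rayleigh down-closed set systems are matroids.  The cell's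
target slots, the Hamming thresholds `{N_F ≥ t}`, are the complements of the uniform matroids; `osN_andOr_slot_neg` is the smallest
excluded pattern; Semple–Welsh 2008 §2 call such matroid complexes independence-correlated.) [cite: Wagner2008, Thm 4.6 (down-closed case)] -/
theorem exists_matroid_of_dictator_osN_nonneg (H : Set (Set ι)) (hH : IsUpperSet H) (hHe : (∅ : Set ι) ∉ H)
    (hpos : ∀ (p : ι → unitInterval) (e f : ι), e ≠ f →
      0 ≤ osN p H (ind {ω : Set ι | e ∈ ω}) (ind {ω : Set ι | f ∈ ω})) :
    ∃ M : Matroid ι, ∀ I : Finset ι, M.Indep (↑I : Set ι) ↔ (↑I : Set ι) ∉ H := by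
  classical
  have hne : (slotComplex H).Nonempty := ⟨∅, by rw [mem_slotComplex, Finset.coe_empty]; exact hHe⟩
  obtain ⟨M, hM⟩ := exists_matroid_of_isRayleighFamily (isRayleighFamily_slotComplex_of_osN_nonneg hpos)
    (isLowerSet_slotComplex hH) hne
  exact ⟨M, fun I => (hM I).trans mem_slotComplex⟩

/-- **Corollary (good first slots are matroidal).**  If the `(2′)` half of the one-step scheme holds for the first slot `H`
(an up-set with `∅ ∉ H`) against ALL pairs of increasing events under ALL product measures — the property conjectured for the
Hamming thresholds and observed numerically exactly for complements of (Rayleigh) matroid complexes (memo G33 §7) — then `Hᶜ` is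
the family of independent sets of a matroid. [this work] -/
theorem exists_matroid_of_osN_nonneg_upperSets (H : Set (Set ι)) (hH : IsUpperSet H) (hHe : (∅ : Set ι) ∉ H)
    (hpos : ∀ (p : ι → unitInterval) (A B : Set (Set ι)), IsUpperSet A → IsUpperSet B → 0 ≤ osN p H (ind A) (ind B)) :
    ∃ M : Matroid ι, ∀ I : Finset ι, M.Indep (↑I : Set ι) ↔ (↑I : Set ι) ∉ H :=
  exists_matroid_of_dictator_osN_nonneg H hH hHe fun p _ _ _ =>
    hpos p _ _ (fun _ _ hst he => hst he) (fun _ _ hst he => hst he)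

/-- **Measure-theoretic form (no `osN`): conditional pairwise negative correlation at all densities forces a matroid.**  If `H` is an
up-set of `Set ι` with `∅ ∉ H` and, for EVERY product measure `prodBernoulli p` and all `e ≠ f`,
`μ(Hᶜ ∩ [e] ∩ [f])·μ(Hᶜ) ≤ μ(Hᶜ ∩ [e])·μ(Hᶜ ∩ [f])` (the coordinates are non-positively correlated under `μ(· ∣ Hᶜ)`), then `Hᶜ` is the
family of independent sets of a matroid on `ι`.  [cite: Wagner2008, Thm 4.6 (down-closed case)] -/
theorem exists_matroid_of_condNC (H : Set (Set ι)) (hH : IsUpperSet H) (hHe : (∅ : Set ι) ∉ H)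
    (hNC : ∀ (p : ι → unitInterval) (e f : ι), e ≠ f →
      (prodBernoulli p).real (Hᶜ ∩ {ω | e ∈ ω} ∩ {ω | f ∈ ω}) * (prodBernoulli p).real Hᶜ ≤
        (prodBernoulli p).real (Hᶜ ∩ {ω | e ∈ ω}) * (prodBernoulli p).real (Hᶜ ∩ {ω | f ∈ ω})) :
    ∃ M : Matroid ι, ∀ I : Finset ι, M.Indep (↑I : Set ι) ↔ (↑I : Set ι) ∉ H := by
  classical
  refine exists_matroid_of_dictator_osN_nonneg H hH hHe fun p e f hef => ?_
  rw [osN_dictator_eq p H hef]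
  linarith [hNC p e f hef]

/-- **Uniform matroids are Rayleigh, in the kernel.**  For a Hamming-threshold first slot `H = {t ≤ |ω ∩ F|}` (complement = the uniform
matroid `U_{t−1}(F)` plus free coordinates off `F`), the slot complex is a Rayleigh family: by `dictator_osN_nonneg_iff_isRayleighFamily`
this is the dictator (disjoint-support) case of `(2′)`, i.e. THEOREM D of the cell (`osN_disjoint_nonneg`: negative association of the
Hamming-ball-conditioned product measure) — Newton's inequalities / Semple–Welsh's independence correlation of uniform matroids.
[cite: SempleWelsh2008, Example 2.2 (uniform matroids are independence-correlated)] -/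
theorem isRayleighFamily_slotComplex_threshold (F : Finset ι) (t : ℕ) :
    IsRayleighFamily (slotComplex {ω : Set ι | t ≤ (F.filter (· ∈ ω)).card}) := by
  -- dictator events are determined by their coordinate (cf. `AdditiveGluingVar975.v975_det_mem`) and increasing
  have hdet : ∀ i : ι, DeterminedBy {ω : Set ι | i ∈ ω} (↑({i} : Finset ι) : Set ι) := fun i => by
    rw [determinedBy_iff]
    intro ω ω' h
    have hi : i ∈ (↑({i} : Finset ι) : Set ι) := by simp
    simp only [Set.mem_setOf_eq]
    exact ⟨fun hω => (show i ∈ ω' ∩ (↑({i} : Finset ι) : Set ι) from h ▸ ⟨hω, hi⟩).1,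
      fun hω' => (show i ∈ ω ∩ (↑({i} : Finset ι) : Set ι) from h.symm ▸ ⟨hω', hi⟩).1⟩
  have hup : ∀ i : ι, IsUpperSet {ω : Set ι | i ∈ ω} := fun i _ _ hst he => hst he
  exact isRayleighFamily_slotComplex_of_osN_nonneg fun p e f hef =>
    osN_disjoint_nonneg p F t (hup e) (hup f) (hdet e) (hdet f) (Finset.disjoint_singleton.mpr hef)

/-- **Non-vacuity: the Hamming-threshold slots yield Mathlib matroids** (uniform of rank `t − 1` on `F`, free off `F`):
for `1 ≤ t` there is `M : Matroid ι` with `M.Indep ↑I ↔ |I ∩ F| < t`. [this work] -/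
theorem exists_matroid_threshold (F : Finset ι) {t : ℕ} (ht : 1 ≤ t) :
    ∃ M : Matroid ι, ∀ I : Finset ι, M.Indep (↑I : Set ι) ↔ (F.filter (· ∈ I)).card < t := by
  classical
  have hHe : (∅ : Set ι) ∉ {ω : Set ι | t ≤ (F.filter (· ∈ ω)).card} := by
    simp only [Set.mem_setOf_eq, Set.mem_empty_iff_false, Finset.filter_false, Finset.card_empty, not_le]
    omega
  obtain ⟨M, hM⟩ := exists_matroid_of_isRayleighFamily (isRayleighFamily_slotComplex_threshold F t)
    (isLowerSet_slotComplex (isUpperSet_threshold F t)) ⟨∅, by rw [mem_slotComplex, Finset.coe_empty]; exact hHe⟩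
  refine ⟨M, fun I => (hM I).trans ?_⟩
  rw [mem_slotComplex]
  simp only [Set.mem_setOf_eq, Finset.mem_coe, not_le]

end Bridge

end SahiOneStep

end Summit.CriticalPhenomena.PercolationContinuityZ3.Theorems
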